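import Summits.QuantumFields.YangMills.Theorems.AlphaInputsT3ACThm2
import Literature.MathematicalPhysics.QuantumFieldTheory.Balaban1983to89.T3AlphaInputsACSchemas
import HarnessLib

/-!
# `AlphaInputsT3AC` — THE BRIDGE, PART 1: the package's data per run, the `e^{E}`-renormalisation of the Radon–Nikodym tower, and the
# inductive inequalities (41)′/(47)′ `dV`-a.e. FOR THE ROUTE'S `resDensity` in the normal form of the Literature interface
# `T3AlphaInputsAC` (constants pulled out, `E_j − E` bookkeeping)

Lane `pub-balaban3d`, seat alpha-1 (LINE 2 of `defn-AlphaInputsT3AC`, route `UnitScaleTilt`; second reading owner g15∕g16 + ★ym-ust-19201-p2).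
The Literature interface `T3AlphaInputsAC.AlphaDataT3 F γ` (typer g40) reads the (α) package through the cell's RESTRICTED density
`resDensity F γ K univ j = towerDensity F K (𝟙_univ·e^{−β_K A}) j` and asks (41)′/(47)′ in the a.e. forms `Ineq41AE`/`Ineq47AE`
(`ρ_j ≤ e^{−Ecst_j + Rm_j}·LF_j[exp(−mainT + Pint + Zterm)]`, `e^{−Ecst_j − Rm_j}·χ_j·exp(−mainT(triv) + Pint(triv)) ≤ ρ_j`, with
`Ecst K j = E_j − E = −Σ_{i<j} E^{(i)}`, `EcstBook`).  The lane's AC tower starts from print's `ρ₀ = e^{−E}·e^{−β_K A}` ((1) p.256) and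
carries `E_k` inside the exponent.  THIS FILE closes the gap between the two normalisations:

* §1 `rnTransport_const_mul_ae`, `rhoSeq_const_mul_ae`, `towerDensity_const_mul_ae` — the Radon–Nikodym transport, hence the whole tower, is
  HOMOGENEOUS under non-negative constants `dV`-a.e. (Mathlib `Measure.rnDeriv_smul_left_of_ne_top`; exact homogeneity is not available for a
  chosen RN version);
* §2 `AlphaInputsT3AC.PkgAt` / `Of.pkgAt` — the package's ∃-bound data at one `(γ, K)` as a record (choice), its AC inputs `X`, its tower `T`,
  and `PkgAt.ineq41_47` (Theorem 2 for it, `AlphaInputsT3ACThm2`);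
* §3 `PkgAt.resDensity_le_ae` / `PkgAt.le_resDensity_ae` — **(41)′ and (47)′ for `resDensity F γ K univ j`, `j ≤ K`, in EXACTLY the
  interface's normal form** with the tower's `LF`, `mainT`, `Pint`, `Zterm`, `χ`, `triv`, `Rm` and `Ecst := E_j − E`: the successor's
  `D_of : AlphaDataT3 F γ` (fields := these objects) gets `Ineq41AE`/`Ineq47AE` by `exact`.
* `AtScaleT3AC` — the owner-endorsed alias of the Summit-side socket `AlphaInputsT3AC L` (ends the name clash with the Literature notion).

Not here (memo LINE2-INTERFACE-MEMO items 5–7, evidence #19 on stmt-QuantumFields-18916): the polymer fields `Loc`/`Pterm`/`enl`/`treeLen` with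
`PintDecomp`/`IsLocal`/`GaugeInv26`/`TermSize`/`LocCover`, `MainTermIsAction` (normalisation check of the lane's `mainT` against `β_K·wilsonAction4`),
`Constraint42Top`, `Regularity68`, `RepAtHeights`, `EnvelopeRegular`'s positivity.  CONDITIONAL on the package; nothing of [Balaban1985UV3]
is asserted.

References: T. Bałaban, Commun. Math. Phys. 102 (1985) 255–275 [Balaban1985UV3], (1)–(2) p.256, (41) p.266, (47) p.267, (62) p.271, Thm 2 p.272.
-/

set_option autoImplicit false

noncomputable section

namespace Summit.QuantumFields.YangMills.Theorems

open MeasureTheory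
open scoped ENNReal
open Literature.MathematicalPhysics.QuantumFieldTheory.Balaban1983to89
open Literature.MathematicalPhysics.QuantumFieldTheory.Balaban1983to89.B10 (Ineq41 Ineq47)
open Literature.MathematicalPhysics.QuantumFieldTheory.Balaban1983to89.AveragingRT (pushDensity rnDensity rnTransport)
open Literature.MathematicalPhysics.QuantumFieldTheory.Balaban1983to89.T3ContinuumYM3Torus
open Literature.MathematicalPhysics.QuantumFieldTheory.Balaban1983to89.T3UnitLawDensityEML (ℰp)
open Literature.MathematicalPhysics.QuantumFieldTheory.Balaban1983to89.T3RestrictedUnitDensity (towerDensity resDensity)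
open Literature.MathematicalPhysics.QuantumFieldTheory.Balaban1983to89.Missing (boltzmann)
open Literature.MathematicalPhysics.QuantumFieldTheory.Balaban1985CMP102
open Literature.MathematicalPhysics.QuantumFieldTheory.Balaban1985CMP102.Setting
open Summit.QuantumFields.Balaban3D.Carriers
open Summit.QuantumFields.Balaban3D.Proofs.Primitives
open Summit.QuantumFields.Balaban3D.Proofs.GroupModelLieC (lieC)
open Summit.QuantumFields.Balaban3D.Proofs.TowerAC
open Summit.QuantumFields.Balaban3D.Proofs.StandardAC
open Summit.QuantumFields.Balaban3D.Proofs.InputsAC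
open Summit.QuantumFields.Balaban3D.Proofs.AlphaAC
open Summit.QuantumFields.Balaban3D.Proofs.Thm2AC

/-- **THE OWNER-ENDORSED ALIAS** of the Summit-side socket: `AtScaleT3AC L` IS `AlphaInputsT3AC L` (the closed `Prop` of this directory), named
apart from the Literature notion `T3AlphaInputsACSchemas.AlphaInputsT3AC D b₀ p₀ ε₀ C68` (a predicate on exposed data). [cite: Balaban1985UV3, Thm 2 p.272] -/
abbrev AtScaleT3AC (L : ℕ) : Prop := AlphaInputsT3AC L

/-! ## §1 Homogeneity of the Radon–Nikodym tower under non-negative constants, `dV`-a.e. -/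

section Scaling

variable {P : Params} {G : Type} [GaugeGroup G] [MeasurableSpace G] [HaarData G] {j : ℕ}

/-- The push-forward of `(c·φ)⁺dU` is `c` times that of `φ⁺dU` (`c ≥ 0`). [folklore] -/
theorem pushDensity_const_mul (avg : GaugeField P j G → GaugeField P (j + 1) G) (φ : Density P j G) {c : ℝ} (hc : 0 ≤ c) :
    pushDensity avg (fun U => c * φ U) = ENNReal.ofReal c • pushDensity avg φ := by
  unfold AveragingRT.pushDensity
  have h1 : (fun U => ENNReal.ofReal (c * φ U)) = ENNReal.ofReal c • fun U => ENNReal.ofReal (φ U) := by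
    funext U
    simp only [Pi.smul_apply, smul_eq_mul, ENNReal.ofReal_mul hc]
  rw [h1, withDensity_smul' _ _ ENNReal.ofReal_ne_top, Measure.map_smul]

/-- **THE RN TRANSPORT IS HOMOGENEOUS `dV`-a.e.**: `T(c·ρ) = c·Tρ` almost everywhere for `c ≥ 0` and an integrable `ρ ≥ 0` (the RN derivative of
`c·ν` is `c` times that of `ν` a.e., Mathlib `Measure.rnDeriv_smul_left_of_ne_top`). [folklore] -/
theorem rnTransport_const_mul_ae (avg : GaugeField P j G → GaugeField P (j + 1) G) (ρ : Density P j G) (h0 : ∀ U, 0 ≤ ρ U)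
    (hρ : Integrable ρ (fieldMeasure P j G)) {c : ℝ} (hc : 0 ≤ c) :
    rnTransport avg (fun U => c * ρ U) =ᵐ[fieldMeasure P (j + 1) G] fun V => c * rnTransport avg ρ V := by
  have h0' : ∀ U, 0 ≤ c * ρ U := fun U => mul_nonneg hc (h0 U)
  haveI : IsFiniteMeasure ((fieldMeasure P j G).withDensity fun U => ENNReal.ofReal (ρ U)) :=
    isFiniteMeasure_withDensity_ofReal hρ.hasFiniteIntegral
  haveI : IsFiniteMeasure (pushDensity avg ρ) := by
    unfold AveragingRT.pushDensity; infer_instance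
  have h := Measure.rnDeriv_smul_left_of_ne_top (pushDensity avg ρ) (fieldMeasure P (j + 1) G)
    (r := ENNReal.ofReal c) ENNReal.ofReal_ne_top
  rw [← pushDensity_const_mul avg ρ hc] at h
  filter_upwards [h] with V hV
  simp only [AveragingRT.rnTransport, if_pos h0, if_pos h0', AveragingRT.rnDensity, hV, Pi.smul_apply, smul_eq_mul,
    ENNReal.toReal_mul, ENNReal.toReal_ofReal hc]

/-- **THE PLAIN ITERATED RN TOWER IS HOMOGENEOUS `dV`-a.e.**: `ρ_k[c·ρ₀] = c·ρ_k[ρ₀]` a.e., every `k` (induction: a.e.-equal non-negative inputs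
have the SAME transport, `Carriers.rnTransport_congr_ae`, then `rnTransport_const_mul_ae`). [folklore] -/
theorem rhoSeq_const_mul_ae (av : ∀ j, Averaging P j G) (ρ₀ : Density P 0 G) (h0 : ∀ U, 0 ≤ ρ₀ U)
    (hi : Integrable ρ₀ (fieldMeasure P 0 G)) {c : ℝ} (hc : 0 ≤ c) :
    ∀ k : ℕ, rhoSeq av (fun U => c * ρ₀ U) k =ᵐ[fieldMeasure P k G] fun V => c * rhoSeq av ρ₀ k V
  | 0 => ae_of_all _ fun _ => rfl
  | k + 1 => by
    have ih := rhoSeq_const_mul_ae av ρ₀ h0 hi hc k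
    have hk0 : ∀ U, 0 ≤ rhoSeq av ρ₀ k U := rhoSeq_nonneg av ρ₀ h0 k
    have hc0 : ∀ U, 0 ≤ rhoSeq av (fun U => c * ρ₀ U) k U := rhoSeq_nonneg av _ (fun U => mul_nonneg hc (h0 U)) k
    show rnTransport (av k).avg (rhoSeq av (fun U => c * ρ₀ U) k) =ᵐ[fieldMeasure P (k + 1) G]
      fun V => c * rnTransport (av k).avg (rhoSeq av ρ₀ k) V
    rw [rnTransport_congr_ae ih hc0 (fun U => mul_nonneg hc (hk0 U))]
    exact rnTransport_const_mul_ae (av k).avg (rhoSeq av ρ₀ k) hk0 (integrable_rhoSeq av ρ₀ hi k) hc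

/-- **THE T³ CELL'S RADON–NIKODYM TOWER IS HOMOGENEOUS `dV`-a.e.**: `towerDensity F K (c·ρ₀) k = c·towerDensity F K ρ₀ k` almost everywhere,
`k ≤ m + K`, `c ≥ 0`, `ρ₀ ≥ 0` integrable (`rhoSeq_const_mul_ae` through `rhoSeq_avT3_eq_towerDensity`). [cite: Balaban1985UV3, (2) p.256] -/
theorem towerDensity_const_mul_ae (F : T3Family) (K : ℕ)
    (ρ₀ : Density (F.P K) 0 (Matrix.specialUnitaryGroup (Fin 2) ℂ)) (h0 : ∀ U, 0 ≤ ρ₀ U)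
    (hi : Integrable ρ₀ (fieldMeasure (F.P K) 0 (Matrix.specialUnitaryGroup (Fin 2) ℂ))) {c : ℝ} (hc : 0 ≤ c)
    (k : ℕ) (hk : k ≤ F.m + K) :
    towerDensity F K (fun U => c * ρ₀ U) k =ᵐ[fieldMeasure (F.P K) k (Matrix.specialUnitaryGroup (Fin 2) ℂ)]
      fun V => c * towerDensity F K ρ₀ k V := by
  have h := rhoSeq_const_mul_ae (avT3 F K) ρ₀ h0 hi hc k
  rw [rhoSeq_avT3_eq_towerDensity (F := F) (K := K) _ k hk, rhoSeq_avT3_eq_towerDensity (F := F) (K := K) ρ₀ k hk] at h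
  exact h

end Scaling

/-! ## §2 The package's data at one `(γ, K)` as a record -/

section Pkg

variable (F : T3Family) (𝔠 : AlphaConsts F.L (suGroupModel 2).N) (γ : ℝ) (hγ : 0 < γ) (hγ1 : γ ≤ (min 𝔠.gamma0 1) ^ 2) (K : ℕ)

/-- **THE PACKAGE'S DATA AT `(γ, K)`**: regular classes, minimizers `U_k`, composite minimizers `U_k(·,h)` (with (42) at `triv`), expansion
data `𝔖`, auxiliary data `𝔄`, and the AC (α) rows for them — the ∃-clause of `AlphaInputsT3AC.Of F 𝔠` at `(γ, K)` as a record.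
[cite: Balaban1985UV3, Thm 1 p.257 + Thm 2 p.272] -/
structure AlphaInputsT3AC.PkgAt where
  /-- regular classes of [Balaban1985Variational] -/
  reg : ℕ → Set (GaugeField (F.P K) 0 (Matrix.specialUnitaryGroup (Fin 2) ℂ))
  /-- minimizers `U_k(V)` -/
  Uk : (k : ℕ) → GaugeField (F.P K) (k + 1) (Matrix.specialUnitaryGroup (Fin 2) ℂ) →
    GaugeField (F.P K) 0 (Matrix.specialUnitaryGroup (Fin 2) ℂ)
  /-- composite minimizers `U_k(V, h)` of (42) -/
  UkH : (k : ℕ) → Hist (F.P K) k → GaugeField (F.P K) k (Matrix.specialUnitaryGroup (Fin 2) ℂ) →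
    GaugeField (F.P K) 0 (Matrix.specialUnitaryGroup (Fin 2) ℂ)
  /-- `U_0(V, triv) = V` -/
  hU0 : ∀ V : GaugeField (F.P K) 0 (Matrix.specialUnitaryGroup (Fin 2) ℂ), UkH 0 (Hist.triv (F.P K) 0) V = V
  /-- `U_{k+1}(V, triv) = U_k(V)` -/
  hUs : ∀ (k : ℕ) (V : GaugeField (F.P K) (k + 1) (Matrix.specialUnitaryGroup (Fin 2) ℂ)),
    UkH (k + 1) (Hist.triv (F.P K) (k + 1)) V = Uk k V
  /-- expansion data (chart values in `𝔰𝔲(2)ᶜ`) -/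
  𝔖 : ∀ k, StepSeries (T3Scales F γ hγ (hγ1.trans (sq_min_one_le _ 𝔠.gamma0_pos)) K) (Matrix.specialUnitaryGroup (Fin 2) ℂ)
    ↥(lieC (suGroupModel 2)) (nblkOf (T3Scales F γ hγ (hγ1.trans (sq_min_one_le _ 𝔠.gamma0_pos)) K) 𝔠.lane.carrier k) k
  /-- auxiliary (α) data -/
  𝔄 : AlphaDataAC (suGroupModel 2) 𝔠 (XT3 F γ hγ (hγ1.trans (sq_min_one_le _ 𝔠.gamma0_pos)) K reg Uk UkH hU0 hUs) 𝔖
  /-- the AC (α) rows hold for these data -/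
  run : RunAlphaAC (suGroupModel 2) 𝔠 (XT3 F γ hγ (hγ1.trans (sq_min_one_le _ 𝔠.gamma0_pos)) K reg Uk UkH hU0 hUs) 𝔖 𝔄

variable {F 𝔠 γ hγ hγ1 K}

namespace AlphaInputsT3AC.PkgAt

variable (p : AlphaInputsT3AC.PkgAt F 𝔠 γ hγ hγ1 K)

/-- The AC external inputs of the package's data (averaging `blockAvg ℰp`). [cite: Balaban1985UV3, (2) p.256] -/
abbrev X : ExternalInputsAC (T3Scales F γ hγ (hγ1.trans (sq_min_one_le _ 𝔠.gamma0_pos)) K) (Matrix.specialUnitaryGroup (Fin 2) ℂ) :=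
  XT3 F γ hγ (hγ1.trans (sq_min_one_le _ 𝔠.gamma0_pos)) K p.reg p.Uk p.UkH p.hU0 p.hUs

/-- The lane's AC tower of the package's data, as a `B10.TowerRun`. [cite: Balaban1985UV3, (38)–(43) p.266] -/
abbrev T : B10.TowerRun := towerOfAC 𝔠.lane p.X p.𝔖

/-- The tower's start constant `E = E_0 = Σ_{i<K} E^{(i)}` ((62)/(64)). [cite: Balaban1985UV3, (62) p.271] -/
abbrev E : ℝ := B10.Ek (inputOfAC 𝔠.lane p.X p.𝔖).Estep K 0

/-- **THEOREM 2 FOR THE PACKAGE'S TOWER**: (41)_k ∧ (47)_k, `k ≤ K` (`Thm2AC.ineq41_47_of_alphaAC` on the window `T3Scales_window`).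
[cite: Balaban1985UV3, Thm 2 p.272] -/
theorem ineq41_47 (k : ℕ) (hk : k ≤ K) : Ineq41 p.T k ∧ Ineq47 p.T k :=
  ineq41_47_of_alphaAC (T3Scales_window F 𝔠 γ hγ hγ1 K) p.run k hk

/-- The tower's density IS `dV`-a.e. the cell's RN tower from `e^{−E}·e^{−β_K A}` (`rho_towerOfAC_ae_eq_towerDensity`). [cite: Balaban1985UV3, (2) p.256] -/
theorem rho_ae_eq (k : ℕ) (hk : k ≤ F.m + K) :
    p.T.ρ k =ᵐ[fieldMeasure (F.P K) k (Matrix.specialUnitaryGroup (Fin 2) ℂ)]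
      towerDensity F K (fun U => Real.exp (-p.E) * boltzmann (F.P K) ((F.scheme ℰp γ).β K) U) k :=
  rho_towerOfAC_ae_eq_towerDensity 𝔠.lane p.X rfl p.𝔖 k hk

/-- **THE ROUTE'S RESTRICTED DENSITY IS `e^{E}` TIMES THE TOWER'S, `dV`-a.e.**: `resDensity F γ K univ j = e^{E}·ρ_j` a.e., `j ≤ m + K`
(`𝟙_univ·e^{−βA} = e^{E}·(e^{−E}e^{−βA})`, homogeneity `towerDensity_const_mul_ae`, `rho_ae_eq`). [cite: Balaban1985UV3, (1)–(2) p.256] -/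
theorem resDensity_ae_eq (k : ℕ) (hk : k ≤ F.m + K) :
    resDensity F γ K Set.univ k =ᵐ[fieldMeasure (F.P K) k (Matrix.specialUnitaryGroup (Fin 2) ℂ)] fun V => Real.exp p.E * p.T.ρ k V := by
  have hρ₀ : ∀ U, 0 ≤ Real.exp (-p.E) * boltzmann (F.P K) ((F.scheme ℰp γ).β K) U := fun U =>
    mul_nonneg (Real.exp_nonneg _) (Missing.boltzmann_pos (G := Matrix.specialUnitaryGroup (Fin 2) ℂ) (F.P K) _ U).le
  have hint : Integrable (fun U => Real.exp (-p.E) * boltzmann (F.P K) ((F.scheme ℰp γ).β K) U)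
      (fieldMeasure (F.P K) 0 (Matrix.specialUnitaryGroup (Fin 2) ℂ)) := by
    have h := integrable_wilsonStart (P := (T3Scales F γ hγ (hγ1.trans (sq_min_one_le _ 𝔠.gamma0_pos)) K).P)
      (G := Matrix.specialUnitaryGroup (Fin 2) ℂ) (g0sq_nonneg (T3Scales F γ hγ (hγ1.trans (sq_min_one_le _ 𝔠.gamma0_pos)) K)) p.E
    rw [wilsonStart_T3_eq] at h
    exact h
  have hstart : Set.univ.indicator (boltzmann (G := Matrix.specialUnitaryGroup (Fin 2) ℂ) (F.P K) ((F.scheme ℰp γ).β K)) =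
      fun U => Real.exp p.E * (Real.exp (-p.E) * boltzmann (F.P K) ((F.scheme ℰp γ).β K) U) := by
    funext U
    rw [Set.indicator_univ, ← mul_assoc, ← Real.exp_add, add_neg_cancel, Real.exp_zero, one_mul]
  have h1 := towerDensity_const_mul_ae F K _ hρ₀ hint (Real.exp_nonneg p.E) k hk
  have h2 := p.rho_ae_eq k hk
  show towerDensity F K (Set.univ.indicator (boltzmann (F.P K) ((F.scheme ℰp γ).β K))) k =ᵐ[_] _
  rw [hstart]
  filter_upwards [h1, h2] with V hV1 hV2
  rw [hV1, hV2]

end AlphaInputsT3AC.PkgAt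

/-- The package at `(γ, K)` is inhabited under `AlphaInputsT3AC.Of F 𝔠`. [cite: Balaban1985UV3, Thm 2 p.272] -/
theorem AlphaInputsT3AC.Of.nonempty_pkgAt (h : AlphaInputsT3AC.Of F 𝔠) (γ : ℝ) (hγ : 0 < γ) (hγ1 : γ ≤ (min 𝔠.gamma0 1) ^ 2)
    (K : ℕ) : Nonempty (AlphaInputsT3AC.PkgAt F 𝔠 γ hγ hγ1 K) := by
  obtain ⟨reg, Uk, UkH, hU0, hUs, 𝔖, 𝔄, hR⟩ := h γ hγ hγ1 K
  exact ⟨⟨reg, Uk, UkH, hU0, hUs, 𝔖, 𝔄, hR⟩⟩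

/-- **THE PACKAGE'S DATA, CHOSEN** (classical choice from `nonempty_pkgAt`): the record the bridge's `AlphaDataT3` fields read at run `K`.
[cite: Balaban1985UV3, Thm 2 p.272] -/
noncomputable def AlphaInputsT3AC.Of.pkgAt (h : AlphaInputsT3AC.Of F 𝔠) (γ : ℝ) (hγ : 0 < γ) (hγ1 : γ ≤ (min 𝔠.gamma0 1) ^ 2)
    (K : ℕ) : AlphaInputsT3AC.PkgAt F 𝔠 γ hγ hγ1 K :=
  Classical.choice (h.nonempty_pkgAt γ hγ hγ1 K)

end Pkg

/-! ## §3 (41)′ and (47)′ for the route's `resDensity`, `dV`-a.e., in the interface's normal form -/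

section NormalForm

variable {F : T3Family} {𝔠 : AlphaConsts F.L (suGroupModel 2).N} {γ : ℝ} {hγ : 0 < γ} {hγ1 : γ ≤ (min 𝔠.gamma0 1) ^ 2} {K : ℕ}
  (p : AlphaInputsT3AC.PkgAt F 𝔠 γ hγ hγ1 K)

/-- **(41)′ FOR THE ROUTE'S DENSITY, `dV`-a.e., CONSTANTS PULLED OUT** (the interface's `Ineq41AE` with the tower's objects and
`Ecst K j := E_j − E`): for `j ≤ K`, almost every `W`,
`resDensity F γ K univ j W ≤ exp(−(E_j − E) + Rm_j) · LF_j(W)[h ↦ exp(−mainT_j(h,W) + Pint_j(h,W) + Zterm_j(h))]` — Theorem 2's (41)_j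
(`PkgAt.ineq41_47`), `LF(Φ + t) = eᵗ·LF(Φ)` (`lf_shift`), and `resDensity = e^{E}·ρ_j` a.e. (`resDensity_ae_eq`). [cite: Balaban1985UV3, (41) p.266 + Thm 2 p.272] -/
theorem AlphaInputsT3AC.PkgAt.resDensity_le_ae (j : ℕ) (hj : j ≤ K) :
    ∀ᵐ W ∂fieldMeasure (F.P K) j (Matrix.specialUnitaryGroup (Fin 2) ℂ),
      resDensity F γ K Set.univ j W ≤
        Real.exp (-(p.T.Ecst j - p.E) + p.T.Rm j) *
          p.T.LF j W (fun h => -(p.T.mainT j h W) + p.T.Pint j h W + p.T.Zterm j h) := by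
  have h41 := (p.ineq41_47 j hj).1
  filter_upwards [p.resDensity_ae_eq j (by omega)] with W hW
  rw [hW]
  have hb := h41 W
  have hshift : p.T.LF j W (fun h => -(p.T.mainT j h W) + p.T.Pint j h W - p.T.Ecst j + p.T.Zterm j h + p.T.Rm j) =
      Real.exp (-(p.T.Ecst j) + p.T.Rm j) * p.T.LF j W (fun h => -(p.T.mainT j h W) + p.T.Pint j h W + p.T.Zterm j h) := by
    rw [← p.T.lf_shift]
    congr 1
    funext h
    ring
  rw [hshift] at hb
  have hE : Real.exp (-(p.T.Ecst j - p.E) + p.T.Rm j) = Real.exp p.E * Real.exp (-(p.T.Ecst j) + p.T.Rm j) := by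
    rw [← Real.exp_add]; congr 1; ring
  rw [hE, mul_assoc]
  exact mul_le_mul_of_nonneg_left hb (Real.exp_nonneg _)

/-- **(47)′ FOR THE ROUTE'S DENSITY, `dV`-a.e., CONSTANTS PULLED OUT** (the interface's `Ineq47AE` with the tower's objects and
`Ecst K j := E_j − E`): for `j ≤ K`, almost every `W`,
`exp(−(E_j − E) − Rm_j) · χ_j(W)·exp(−mainT_j(triv,W) + Pint_j(triv,W)) ≤ resDensity F γ K univ j W` — Theorem 2's (47)_j and
`resDensity = e^{E}·ρ_j` a.e. [cite: Balaban1985UV3, (47) p.267 + Thm 2 p.272] -/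
theorem AlphaInputsT3AC.PkgAt.le_resDensity_ae (j : ℕ) (hj : j ≤ K) :
    ∀ᵐ W ∂fieldMeasure (F.P K) j (Matrix.specialUnitaryGroup (Fin 2) ℂ),
      Real.exp (-(p.T.Ecst j - p.E) - p.T.Rm j) *
          (p.T.χ j W * Real.exp (-(p.T.mainT j (p.T.triv j) W) + p.T.Pint j (p.T.triv j) W)) ≤
        resDensity F γ K Set.univ j W := by
  have h47 := (p.ineq41_47 j hj).2
  filter_upwards [p.resDensity_ae_eq j (by omega)] with W hW
  rw [hW]
  have hb := h47 W
  have hsplit : p.T.χ j W * Real.exp (-(p.T.mainT j (p.T.triv j) W) + p.T.Pint j (p.T.triv j) W - p.T.Ecst j - p.T.Rm j) =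
      Real.exp (-(p.T.Ecst j) - p.T.Rm j) *
        (p.T.χ j W * Real.exp (-(p.T.mainT j (p.T.triv j) W) + p.T.Pint j (p.T.triv j) W)) := by
    rw [mul_left_comm, ← Real.exp_add]; congr 2; ring
  rw [hsplit] at hb
  have hE : Real.exp (-(p.T.Ecst j - p.E) - p.T.Rm j) = Real.exp p.E * Real.exp (-(p.T.Ecst j) - p.T.Rm j) := by
    rw [← Real.exp_add]; congr 1; ring
  rw [hE, mul_assoc]
  exact mul_le_mul_of_nonneg_left hb (Real.exp_nonneg _)

end NormalForm

end Summit.QuantumFields.YangMills.Theorems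

end
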